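import Summits.AnomalousDissipation.AnomalousDissipation.Theorems.SolenoidalFractalHomogenisationLagrangianStepCellEnergyTDualDefs
import HarnessLib

/-!
# K1L_D `stub_cellEnergyT` by DUALITY, part 2/3: adjoint existence, Young pairings, `UniformSlowLeak ⇒ (F)`, the sector-wise Young bound

Part 2: time reflection of a.e. statements, weak divergence-freeness of the reversed carrier, EXISTENCE of the adjoint cell solution (Lions,
`PassiveVectorTensorLionsExistence`), Young-type pairing bounds, the glue `cellEnergyT_of_uniformSlowLeak` (uniform (F) ⇒ the v21 `stub_cellEnergyT`
text with `C = 36k²Λ²/(π⁴lo²c)`, `ν₀ = 1`, `K = 2`), the typed split `uniformSlowLeak_of : SlowModeBound → SectorCount → MeanConservation → UniformSlowLeak`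
(PROVED), and the sector-wise Young bound `abs_integral_inner_le_young_sector` with the single-mode Parseval identity.

Provenance: the TEXT of every declaration below is planner `ad-ideate-p4` g10's PORT-READY crux workfile
`Cruxes/LagrangianRenormalisationStep/CellEnergyTPort.lean` v2 (commit f414c08b2b27, sha16 2d92a09157a6ab13; finding F-p4g10-1, lens «control»;
`lean check` rc 0 / 0 sorry), split VERBATIM into three Theorems files of ≤ 400 lines (`…CellEnergyTDualDefs` → `…CellEnergyTDualLeak` →
`…CellEnergyTDual`) by prover seat `ad-k3l-bookkeeping-p1` g4 (cell STATUS 2026-08-28T14:13:02Z O4 / 14:28:06Z), with the one hypothesis D1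
`PairingConst` DISCHARGED in the last file from ad-lit g25's `Literature.Analysis.FluidPDE.PassiveVectorTensorDuality` (p640160).  The registered
stub `stub_cellEnergyT` of K1L_D (stmt-AnomalousDissipation-27980) is ALREADY CLOSED by name by the lead's primal proof (p640158, `cellEnergyT_W`);
this chain is the independent DUAL proof, giving the STRONGER uniform-in-`T` clause (F) (`CellEnergyClausesNoE`, the v21 text) and (F_T) a fortiori
(`--supports stmt-AnomalousDissipation-27980 --as helper`; no registered stub name is redeclared).  Infrastructure for route-1's rung leaf F-D1.A0
(a frontier FORMAL rung); NOT a proof of the crux, of Onsager's conjecture or of anomalous dissipation.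
-/

set_option linter.dupNamespace false

noncomputable section

namespace Summit.AnomalousDissipation.AnomalousDissipation.Theorems.SolenoidalFractalHomogenisation.LagrangianStep.CellEnergyT

open Literature.Analysis Literature.Analysis.FluidPDE Literature.Analysis.FunctionSpaces
open Literature.Analysis.FluidPDE.LatticeShear
open MeasureTheory Set Filter Function UnitAddTorus
open scoped ENNReal NNReal InnerProductSpace Topology
open Summit.AnomalousDissipation.AnomalousDissipation.Theorems.SolenoidalFractalHomogenisation.RealisedQuasiStaticCellLaw

/-- Reflection `r ↦ t₀ − r` of an a.e. statement on `(0,t₀)`. [folklore] -/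
theorem ae_restrict_Ioo_reflect {t₀ : ℝ} {P : ℝ → Prop} (h : ∀ᵐ r ∂(volume.restrict (Ioo 0 t₀)), P r) :
    ∀ᵐ s ∂(volume.restrict (Ioo 0 t₀)), P (t₀ - s) := by
  rw [ae_restrict_iff' measurableSet_Ioo] at h ⊢
  have h' := (Measure.measurePreserving_sub_left volume t₀).quasiMeasurePreserving.ae h
  filter_upwards [h'] with s hs hsI
  exact hs ⟨by linarith [hsI.2], by linarith [hsI.1]⟩

/-- A property holding a.e. on a nondegenerate interval holds somewhere in it. [folklore] -/
theorem exists_of_ae_Ioo {a c : ℝ} (hac : a < c) {P : ℝ → Prop} (h : ∀ᵐ s ∂(volume.restrict (Ioo a c)), P s) :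
    ∃ s ∈ Ioo a c, P s := by
  have hne : NeBot (ae (volume.restrict (Ioo a c))) := by
    rw [ae_neBot, Ne, Measure.restrict_eq_zero, Real.volume_Ioo, ENNReal.ofReal_eq_zero, not_le, sub_pos]
    exact hac
  obtain ⟨s, hs⟩ := (h.and (ae_restrict_mem measurableSet_Ioo)).exists
  exact ⟨s, hs.2, hs.1⟩

/-- The reversed cell carrier is weakly divergence free for a.e. `r ∈ (0,t₀)` whenever a weak solution on `(0,T) ⊇ (0,t₀)` exists (the
class records `∇·b(t) = 0` a.e.). [folklore] -/
theorem ae_isWeaklyDivFree_revCarrier {b : ℝ → VF} {T t₀ : ℝ} (ht₀ : t₀ ≤ T) {𝔹 : Torus.Visc4 (Fin 3)} {F : VF} {u : ℝ → VF}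
    (hu : Torus.IsWeakTensorPassiveVectorOn 0 T 𝔹 b F u) :
    ∀ᵐ r ∂(volume.restrict (Ioo 0 t₀)), FunctionSpaces.Torus.IsWeaklyDivFree (revCarrier b t₀ r) := by
  have h1 := ae_restrict_Ioo_reflect
    (ae_restrict_of_ae_restrict_of_subset (Ioo_subset_Ioo_right ht₀) hu.ae_isWeaklyDivFree_carrier)
  filter_upwards [h1] with r hr
  intro θ hθ
  have h0 := hr θ hθ
  simp only [revCarrier_apply, inner_neg_left, integral_neg, neg_eq_zero]
  exact h0

/-- **Existence of the adjoint.** For every weak cell solution `u` on `(0,T)` (tensor `(1/n²)•𝔸` in the `ν`-scaled window, carrier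
`cellField`), every `t₀ ∈ (0,T]` and every `L²` weakly div-free datum `φ`, the ADJOINT cell problem — tensor `majorTranspose ((1/n²)•𝔸)`,
carrier `revCarrier (cellField …) t₀` — has a weak solution on `(0,t₀)` (Lions, `exists_isWeakTensorPassiveVectorOn`; the transposed tensor
is in the same window by `nearIso_majorTranspose_iff`). [cite: Evans2010, §7.1.2 Thm. 3] -/
theorem exists_adjoint {k : ℕ} (W : LatticeWord k) (M : ℝ) (hM : 0 < M) {lo hi lam ν : ℝ} (hlo : 0 < lo) (hlam : 0 < lam)
    (hν : 0 < ν) {n : ℕ} (hn : 0 < n) {𝔸 : Torus.Visc4 (Fin 3)} (hA : Torus.NearIso 𝔸 (ν * (lo / lam)) (ν * (hi * lam)))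
    {T : ℝ} {F : VF} {u : ℝ → VF}
    (hu : Torus.IsWeakTensorPassiveVectorOn 0 T ((1 / (n:ℝ) ^ 2) • 𝔸) (cellField W M hM ν hν n) F u)
    {t₀ : ℝ} (ht₀ : t₀ ∈ Ioc 0 T) {φ : VF} (hφ2 : MemLp φ 2 volume) (hφdiv : FunctionSpaces.Torus.IsWeaklyDivFree φ) :
    ∃ ψ : ℝ → VF, Torus.IsWeakTensorPassiveVectorOn 0 t₀ (Torus.majorTranspose ((1 / (n:ℝ) ^ 2) • 𝔸))
      (revCarrier (cellField W M hM ν hν n) t₀) φ ψ := by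
  have hn' : (0:ℝ) < n := by exact_mod_cast hn
  have hN : Torus.NearIso ((1 / (n:ℝ) ^ 2) • 𝔸) ((1 / (n:ℝ) ^ 2) * (ν * (lo / lam))) ((1 / (n:ℝ) ^ 2) * (ν * (hi * lam))) :=
    hA.smul (by positivity)
  have hN' := (Torus.nearIso_majorTranspose_iff _ _ _).2 hN
  have hlo' : 0 < (1 / (n:ℝ) ^ 2) * (ν * (lo / lam)) := by positivity
  exact Torus.exists_isWeakTensorPassiveVectorOn ht₀.1 hN' hlo' (memLp_top_stLift_revCarrier_cellField W M hM hν n t₀ t₀)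
    (ae_isWeaklyDivFree_revCarrier ht₀.2 hu) hφ2 hφdiv

/-- `L²` pairings of slices are integrable. [folklore] -/
theorem integrable_inner₂ {f g : VF} (hf : MemLp f 2 volume) (hg : MemLp g 2 volume) :
    Integrable (fun x => ⟪f x, g x⟫_ℝ) volume :=
  FunctionSpaces.integrable_inner_of_eLpNorm_two_lt_top hf.1 hg.1 hf.2 hg.2

/-- Young's inequality for the `L²(T³)` pairing. [folklore] -/
theorem abs_integral_inner_le_young {f g : VF} (hf : MemLp f 2 volume) (hg : MemLp g 2 volume) {η : ℝ} (hη : 0 < η) :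
    |∫ x, ⟪f x, g x⟫_ℝ| ≤ (∫ x, ‖f x‖ ^ 2) / (2 * η) + η / 2 * ∫ x, ‖g x‖ ^ 2 := by
  have hfi : Integrable (fun x => ‖f x‖ ^ 2) volume := hf.integrable_norm_pow two_ne_zero
  have hgi : Integrable (fun x => ‖g x‖ ^ 2) volume := hg.integrable_norm_pow two_ne_zero
  have hpt : ∀ x, |⟪f x, g x⟫_ℝ| ≤ ‖f x‖ ^ 2 / (2 * η) + η / 2 * ‖g x‖ ^ 2 := by
    intro x
    refine (abs_real_inner_le_norm (f x) (g x)).trans ?_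
    have key : 2 * η * (‖f x‖ * ‖g x‖) ≤ ‖f x‖ ^ 2 + η ^ 2 * ‖g x‖ ^ 2 := by
      nlinarith [sq_nonneg (‖f x‖ - η * ‖g x‖)]
    have e : ‖f x‖ ^ 2 / (2 * η) + η / 2 * ‖g x‖ ^ 2 = (‖f x‖ ^ 2 + η ^ 2 * ‖g x‖ ^ 2) / (2 * η) := by
      field_simp
    rw [e, le_div_iff₀ (by positivity)]
    linarith
  calc |∫ x, ⟪f x, g x⟫_ℝ| ≤ ∫ x, |⟪f x, g x⟫_ℝ| := abs_integral_le_integral_abs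
    _ ≤ ∫ x, (‖f x‖ ^ 2 / (2 * η) + η / 2 * ‖g x‖ ^ 2) :=
        integral_mono_of_nonneg (ae_of_all _ fun x => abs_nonneg _) ((hfi.div_const _).add (hgi.const_mul _))
          (ae_of_all _ hpt)
    _ = (∫ x, ‖f x‖ ^ 2) / (2 * η) + η / 2 * ∫ x, ‖g x‖ ^ 2 := by
        rw [integral_add (hfi.div_const _) (hgi.const_mul _), integral_div, integral_const_mul]

/-- Smallness form of Young: `‖f‖² ≤ κ²/(E+1)` and `‖g‖² ≤ E` give `|⟨f, g⟩| ≤ κ`. [folklore] -/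
theorem abs_integral_inner_le_of_small {f g : VF} (hf : MemLp f 2 volume) (hg : MemLp g 2 volume) {κ E : ℝ}
    (hκ : 0 < κ) (hE : 0 ≤ E) (hfε : ∫ x, ‖f x‖ ^ 2 ≤ κ * (κ / (E + 1))) (hgE : ∫ x, ‖g x‖ ^ 2 ≤ E) :
    |∫ x, ⟪f x, g x⟫_ℝ| ≤ κ := by
  have hη : 0 < κ / (E + 1) := by positivity
  have h := abs_integral_inner_le_young hf hg hη
  have h1 : (∫ x, ‖f x‖ ^ 2) / (2 * (κ / (E + 1))) ≤ κ / 2 := by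
    rw [div_le_iff₀ (by positivity)]
    calc ∫ x, ‖f x‖ ^ 2 ≤ κ * (κ / (E + 1)) := hfε
      _ = κ / 2 * (2 * (κ / (E + 1))) := by ring
  have h2 : κ / (E + 1) / 2 * ∫ x, ‖g x‖ ^ 2 ≤ κ / 2 := by
    calc κ / (E + 1) / 2 * ∫ x, ‖g x‖ ^ 2 ≤ κ / (E + 1) / 2 * E := mul_le_mul_of_nonneg_left hgE (by positivity)
      _ = κ / 2 * (E / (E + 1)) := by ring
      _ ≤ κ / 2 * 1 := mul_le_mul_of_nonneg_left ((div_le_one (by positivity)).2 (by linarith)) (by positivity)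
      _ = κ / 2 := mul_one _
  linarith

/-- **Glue (PROVED): `UniformSlowLeak` closes the v21 stub `stub_cellEnergyT` AS TYPED** (statement copied verbatim from
`Cruxes/LagrangianRenormalisationStep/Lines/onelevel.lean` v21), with `C = 36k²Λ²/(π⁴lo²c)`, `ν₀ = 1`, `K = 2`; clause (C) is the landed
`cell_corrector_content` (p634914, constant `9k²Λ²/(π⁴lo²c) ≤ C`). -/
theorem cellEnergyT_of_uniformSlowLeak (hU : UniformSlowLeak) :
    ∀ k (W : Literature.Analysis.FluidPDE.LatticeShear.LatticeWord k) (M : ℝ) (hM : 0 < M) (c : ℝ), 0 < c →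
    ∀ lo hi Λ β : ℝ, 0 < lo → lo ≤ 1 → 1 ≤ hi → 1 < Λ → 0 ≤ β →
      ∃ C : ℝ, 0 ≤ C ∧ ∃ ν₀ > (0:ℝ), ∃ K > (0:ℝ), CellEnergyClausesNoE W M hM c lo hi Λ β C ν₀ K := by
  intro k W M hM c hc lo hi Λ β hlo _hlo1 _hhi hΛ _hβ
  refine ⟨36 * (k:ℝ) ^ 2 * Λ ^ 2 / (Real.pi ^ 4 * lo ^ 2 * c), by positivity, 1, one_pos, 2, two_pos, ?_⟩
  intro ν hν n 𝔸 hodd hwin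
  refine ⟨?_, ?_⟩
  · intro L hL hLn F hF hFhigh T hT u hu
    exact hU k W M hM c hc lo hi Λ β hlo hΛ.le 1 2 one_pos (by norm_num) ν hν n 𝔸 hodd hwin L hL hLn F hF hFhigh T hT u hu
  · intro ℓ hℓ hband p hp hpℓ T hT w hw
    have h := cell_corrector_content W M hM hc hlo hΛ.le one_pos (by norm_num : (1:ℝ) ≤ 2) ν hν n 𝔸 hodd hwin ℓ hℓ hband p hp
      hpℓ T hT w hw
    filter_upwards [h] with t ht
    refine ht.trans ?_
    have hnn : 0 ≤ (c * ‖Torus.latticeVec ℓ‖ ^ 2 / ((n:ℝ) ^ 2 * ν ^ 2)) * ∫ x, ‖(UnitAddTorus.mFourier ℓ x).re • p‖ ^ 2 :=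
      mul_nonneg (by positivity) (integral_nonneg fun _ => by positivity)
    have hC : 9 * (k:ℝ) ^ 2 * Λ ^ 2 / (Real.pi ^ 4 * lo ^ 2 * c) ≤ 36 * (k:ℝ) ^ 2 * Λ ^ 2 / (Real.pi ^ 4 * lo ^ 2 * c) :=
      div_le_div_of_nonneg_right (by nlinarith [mul_nonneg (sq_nonneg (k:ℝ)) (sq_nonneg Λ)]) (by positivity)
    calc 9 * (k:ℝ) ^ 2 * Λ ^ 2 / (Real.pi ^ 4 * lo ^ 2 * c) * (c * ‖Torus.latticeVec ℓ‖ ^ 2 / ((n:ℝ) ^ 2 * ν ^ 2)) *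
            ∫ x, ‖(UnitAddTorus.mFourier ℓ x).re • p‖ ^ 2
          = 9 * (k:ℝ) ^ 2 * Λ ^ 2 / (Real.pi ^ 4 * lo ^ 2 * c) *
            ((c * ‖Torus.latticeVec ℓ‖ ^ 2 / ((n:ℝ) ^ 2 * ν ^ 2)) * ∫ x, ‖(UnitAddTorus.mFourier ℓ x).re • p‖ ^ 2) := by ring
      _ ≤ 36 * (k:ℝ) ^ 2 * Λ ^ 2 / (Real.pi ^ 4 * lo ^ 2 * c) *
            ((c * ‖Torus.latticeVec ℓ‖ ^ 2 / ((n:ℝ) ^ 2 * ν ^ 2)) * ∫ x, ‖(UnitAddTorus.mFourier ℓ x).re • p‖ ^ 2) :=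
          mul_le_mul_of_nonneg_right hC hnn
      _ = _ := by ring

/-- **Assembly (PROVED): `SlowModeBound → SectorCount → MeanConservation → UniformSlowLeak`.**  Bookkeeping: `ν < ν₀ ≤ K/2` gives
`⌈K/ν⌉₊ ≥ 3`, so `3L ≤ n` and `2L < n`; mode `0` of `u t` vanishes (mean conservation + no low modes in `F`); each slow `ℓ ≠ 0` contributes
`≤ 18k²Λ²L²/(π⁴n²ν²lo²)·‖P_{Σ(ℓ)}F‖²`; the sector count gives the factor `2‖F‖²`. -/
theorem uniformSlowLeak_of (hS : SlowModeBound) (hC : SectorCount) (hM0 : MeanConservation) : UniformSlowLeak := by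
  intro k W M hM c hc lo hi Λ β hlo hΛ ν₀ K hν₀ h2K ν hν n 𝔸 _hodd hwin L hL hLn F hF hFhigh T _hT u hu
  obtain ⟨lam, hlam, hA⟩ := hwin
  have hνpos : 0 < ν := hν.1
  have hlam0 : 0 < lam := lt_of_lt_of_le one_pos hlam.1
  -- `⌈K/ν⌉₊ ≥ 3`, hence `3L ≤ n`
  have hKν : (2:ℝ) < K / ν := by
    rw [lt_div_iff₀ hνpos]; nlinarith [hν.2]
  have hceilN : 3 ≤ ⌈K / ν⌉₊ := by
    have h2 : (2:ℝ) < (⌈K / ν⌉₊ : ℝ) := hKν.trans_le (Nat.le_ceil _)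
    have h3 : 2 < ⌈K / ν⌉₊ := by exact_mod_cast h2
    omega
  have hceil : (3:ℝ) ≤ (⌈K / ν⌉₊ : ℝ) := by exact_mod_cast hceilN
  have h3L : 3 * L ≤ n := by nlinarith
  have hnR : (0:ℝ) < n := by linarith
  have hn : 0 < n := by exact_mod_cast hnR
  have h2L : 2 * L < n := by linarith
  -- carrier lift in `L^∞` and the datum in `L²`
  have hb : MemLp (FunctionSpaces.Torus.stLift (cellField W M hM ν hν.1 n)) ∞
      (volume.restrict (Ioo 0 T ×ˢ (univ : Set (EuclideanSpace ℝ (Fin 3))))) := by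
    unfold cellField
    exact memLp_top_stLift_cell _ n T
  have hF2 : MemLp F 2 volume := memLp_two_of_memSobolev_one_complexify hF.1
  -- mode `0`
  have hF0 : ∀ i, modeCoeff 0 F i = 0 := hFhigh 0 (by rw [Torus.latticeVec_zero, norm_zero]; positivity)
  have h0 : ∀ᵐ t ∂(volume.restrict (Ioo 0 T)), sectorEnergy 0 (u t) = 0 := by
    filter_upwards [hM0 T _ _ hb F u hF2 hu] with t ht
    simp only [sectorEnergy, ht, hF0, norm_zero]
    simp
  -- per-mode bounds on the punctured slow box
  have hmode : ∀ᵐ t ∂(volume.restrict (Ioo 0 T)), ∀ ℓ ∈ (slowBox L).erase 0,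
      sectorEnergy ℓ (u t) ≤
        18 * (k:ℝ) ^ 2 * lam ^ 2 * ‖Torus.latticeVec ℓ‖ ^ 2 / (Real.pi ^ 4 * (n:ℝ) ^ 2 * ν ^ 2 * lo ^ 2) *
          pairSectorEnergy n ℓ F := by
    refine (Filter.eventually_all_finset _).2 fun ℓ hℓ => ?_
    have hℓ0 : ℓ ≠ 0 := Finset.ne_of_mem_erase hℓ
    have hℓL : ‖Torus.latticeVec ℓ‖ ≤ L := norm_le_of_mem_slowBox (Finset.mem_of_mem_erase hℓ)
    exact hS k W M hM lo hi lam hlo hlam.1 ν hν.1 n hn 𝔸 hA F hF hFhigh T u hu ℓ hℓ0 (by linarith)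
  filter_upwards [h0, hmode] with t ht0 ht
  -- the constant per mode is at most `18k²Λ²L²/(π⁴n²ν²lo²)`
  set A : ℝ := 18 * (k:ℝ) ^ 2 * Λ ^ 2 * L ^ 2 / (Real.pi ^ 4 * (n:ℝ) ^ 2 * ν ^ 2 * lo ^ 2) with hAdef
  have hterm : ∀ ℓ ∈ (slowBox L).erase 0, sectorEnergy ℓ (u t) ≤ A * pairSectorEnergy n ℓ F := by
    intro ℓ hℓ
    have hℓL : ‖Torus.latticeVec ℓ‖ ≤ L := norm_le_of_mem_slowBox (Finset.mem_of_mem_erase hℓ)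
    refine (ht ℓ hℓ).trans (mul_le_mul_of_nonneg_right ?_ (pairSectorEnergy_nonneg _ _ _))
    rw [hAdef]
    refine div_le_div_of_nonneg_right ?_ (by positivity)
    have h1 : lam ^ 2 ≤ Λ ^ 2 := pow_le_pow_left₀ hlam0.le hlam.2 2
    have h2 : ‖Torus.latticeVec ℓ‖ ^ 2 ≤ L ^ 2 := pow_le_pow_left₀ (norm_nonneg _) hℓL 2
    have h3 : 0 ≤ (k:ℝ) ^ 2 := sq_nonneg _
    calc 18 * (k:ℝ) ^ 2 * lam ^ 2 * ‖Torus.latticeVec ℓ‖ ^ 2 = 18 * (k:ℝ) ^ 2 * (lam ^ 2 * ‖Torus.latticeVec ℓ‖ ^ 2) := by ring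
      _ ≤ 18 * (k:ℝ) ^ 2 * (Λ ^ 2 * L ^ 2) :=
          mul_le_mul_of_nonneg_left (mul_le_mul h1 h2 (sq_nonneg _) (by positivity)) (by positivity)
      _ = 18 * (k:ℝ) ^ 2 * Λ ^ 2 * L ^ 2 := by ring
  have hsum : ∑ ℓ ∈ (slowBox L).erase 0, sectorEnergy ℓ (u t) ≤ A * ∑ ℓ ∈ (slowBox L).erase 0, pairSectorEnergy n ℓ F := by
    rw [Finset.mul_sum]
    exact Finset.sum_le_sum hterm
  have hA0 : 0 ≤ A := by rw [hAdef]; positivity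
  have hcount := hC n L hL h2L F hF
  rw [lowEnergy_eq_sum, ← Finset.add_sum_erase _ _ (zero_mem_slowBox hL.le), ht0, zero_add]
  calc ∑ ℓ ∈ (slowBox L).erase 0, sectorEnergy ℓ (u t) ≤ A * ∑ ℓ ∈ (slowBox L).erase 0, pairSectorEnergy n ℓ F := hsum
    _ ≤ A * (2 * ∫ x, ‖F x‖ ^ 2) := mul_le_mul_of_nonneg_left hcount hA0
    _ = 36 * (k:ℝ) ^ 2 * Λ ^ 2 / (Real.pi ^ 4 * lo ^ 2 * c) * (c * L ^ 2 / ((n:ℝ) ^ 2 * ν ^ 2)) * ∫ x, ‖F x‖ ^ 2 := by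
        rw [hAdef]
        field_simp
        ring

/-- **`SlowModeBound → UniformSlowLeak` (PROVED net split).** [this file] -/
theorem uniformSlowLeak_of_slowModeBound (hS : SlowModeBound) : UniformSlowLeak :=
  uniformSlowLeak_of hS sectorCount meanConservation

/-- **`SlowModeBound` ⇒ the v21 registered stub `stub_cellEnergyT` text verbatim (PROVED net chain).** [this file] -/
theorem cellEnergyT_of_slowModeBound (hS : SlowModeBound) :
    ∀ k (W : Literature.Analysis.FluidPDE.LatticeShear.LatticeWord k) (M : ℝ) (hM : 0 < M) (c : ℝ), 0 < c →
    ∀ lo hi Λ β : ℝ, 0 < lo → lo ≤ 1 → 1 ≤ hi → 1 < Λ → 0 ≤ β →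
      ∃ C : ℝ, 0 ≤ C ∧ ∃ ν₀ > (0:ℝ), ∃ K > (0:ℝ), CellEnergyClausesNoE W M hM c lo hi Λ β C ν₀ K :=
  cellEnergyT_of_uniformSlowLeak (uniformSlowLeak_of_slowModeBound hS)

/-- Young without square roots: `(∀ α > 0, |x| ≤ α/2·P + D/(2α)) ⇒ x² ≤ P·D`. [folklore] -/
theorem sq_le_mul_of_young {x P D : ℝ} (hP : 0 ≤ P) (hD : 0 ≤ D)
    (h : ∀ α : ℝ, 0 < α → |x| ≤ α / 2 * P + D / (2 * α)) : x ^ 2 ≤ P * D := by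
  by_cases hx : x = 0
  · rw [hx]; simpa using mul_nonneg hP hD
  have hxpos : 0 < |x| := abs_pos.2 hx
  have h2 : ∀ α : ℝ, 0 < α → 2 * α * |x| ≤ α ^ 2 * P + D := by
    intro α hα
    have e : 2 * α * (α / 2 * P + D / (2 * α)) = α ^ 2 * P + D := by field_simp
    calc 2 * α * |x| ≤ 2 * α * (α / 2 * P + D / (2 * α)) := mul_le_mul_of_nonneg_left (h α hα) (by positivity)
      _ = α ^ 2 * P + D := e
  rcases hP.eq_or_lt with hP0 | hPpos
  · exfalso
    have h3 := h2 ((D + 1) / (2 * |x|)) (by positivity)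
    rw [← hP0, mul_zero, zero_add] at h3
    have e : 2 * ((D + 1) / (2 * |x|)) * |x| = D + 1 := by field_simp
    linarith
  · have h3 := h2 (|x| / P) (div_pos hxpos hPpos)
    have e1 : 2 * (|x| / P) * |x| = 2 * (x ^ 2 / P) := by rw [← sq_abs x]; field_simp
    have e2 : (|x| / P) ^ 2 * P = x ^ 2 / P := by rw [div_pow, sq_abs]; field_simp
    rw [e1, e2] at h3
    have h4 : x ^ 2 / P ≤ D := by linarith
    rw [div_le_iff₀ hPpos] at h4
    linarith [mul_comm D P]


/-- **Sector pairing with a Young parameter.** If `F ∈ L²` has no modes at `±ℓ` and `g ∈ L²` has Fourier support in the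
pair-sector `Σ(ℓ)`, then for every `α > 0`, `|∫⟪F, g⟫| ≤ α/2 · ‖P_{Σ(ℓ)}F‖² + (∫‖g‖² − ‖ĝ(ℓ)‖² − ‖ĝ(−ℓ)‖²)/(2α)` (Parseval
`hasSum_re_inner_mFourierCoeff_complexify`, termwise Young, and the two support conditions). [cite: Grafakos2014, Prop. 3.2.7 (3)] -/
theorem abs_integral_inner_le_young_sector {n : ℕ} {ℓ : Fin 3 → ℤ} (hℓ : ℓ ≠ 0) {F g : VF}
    (hF2 : MemLp F 2 volume) (hg2 : MemLp g 2 volume)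
    (hFℓ : ∀ k', k' = ℓ ∨ k' = -ℓ → mFourierCoeff (FunctionSpaces.EuclideanSpace.complexify ∘ F) k' = 0)
    (hg : ∀ k', ¬ ((∀ i, (n:ℤ) ∣ k' i - ℓ i) ∨ (∀ i, (n:ℤ) ∣ k' i + ℓ i)) →
      mFourierCoeff (FunctionSpaces.EuclideanSpace.complexify ∘ g) k' = 0)
    {D : ℝ} (hD : (∫ x, ‖g x‖ ^ 2) - (‖mFourierCoeff (FunctionSpaces.EuclideanSpace.complexify ∘ g) ℓ‖ ^ 2 +
      ‖mFourierCoeff (FunctionSpaces.EuclideanSpace.complexify ∘ g) (-ℓ)‖ ^ 2) ≤ D)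
    {α : ℝ} (hα : 0 < α) :
    |∫ x, ⟪F x, g x⟫_ℝ| ≤ α / 2 * pairSectorEnergy n ℓ F + D / (2 * α) := by
  classical
  set Fh := mFourierCoeff (FunctionSpaces.EuclideanSpace.complexify ∘ F) with hFh
  set gh := mFourierCoeff (FunctionSpaces.EuclideanSpace.complexify ∘ g) with hgh
  have hFi : Integrable F volume := hF2.integrable one_le_two
  have hPF : HasSum (fun k => ‖Fh k‖ ^ 2) (∫ x, ‖F x‖ ^ 2) :=
    FunctionSpaces.Torus.hasSum_sq_norm_mFourierCoeff_complexify hF2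
  have hPg : HasSum (fun k => ‖gh k‖ ^ 2) (∫ x, ‖g x‖ ^ 2) :=
    FunctionSpaces.Torus.hasSum_sq_norm_mFourierCoeff_complexify hg2
  have hpair : HasSum (fun k => (⟪Fh k, gh k⟫_ℂ).re) (∫ x, ⟪F x, g x⟫_ℝ) :=
    FunctionSpaces.Torus.hasSum_re_inner_mFourierCoeff_complexify hF2 hg2
  set S : Set (Fin 3 → ℤ) := PairSector n ℓ with hS
  set E : Finset (Fin 3 → ℤ) := {ℓ, -ℓ} with hE
  set maj : (Fin 3 → ℤ) → ℝ := fun k => α / 2 * S.indicator (fun k => ‖Fh k‖ ^ 2) k +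
    (2 * α)⁻¹ * ((E : Set (Fin 3 → ℤ))ᶜ).indicator (fun k => ‖gh k‖ ^ 2) k with hmaj
  have hs1 : Summable fun k => α / 2 * S.indicator (fun k => ‖Fh k‖ ^ 2) k := (hPF.summable.indicator _).mul_left _
  have hs2 : Summable fun k => (2 * α)⁻¹ * ((E : Set (Fin 3 → ℤ))ᶜ).indicator (fun k => ‖gh k‖ ^ 2) k :=
    (hPg.summable.indicator _).mul_left _
  have hmaj_s : Summable maj := hs1.add hs2
  -- pointwise domination
  have hdom : ∀ k, |(⟪Fh k, gh k⟫_ℂ).re| ≤ maj k := by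
    intro k
    have hi1 : 0 ≤ S.indicator (fun k => ‖Fh k‖ ^ 2) k := Set.indicator_nonneg (fun _ _ => by positivity) _
    have hi2 : 0 ≤ ((E : Set (Fin 3 → ℤ))ᶜ).indicator (fun k => ‖gh k‖ ^ 2) k :=
      Set.indicator_nonneg (fun _ _ => by positivity) _
    have hmaj0 : 0 ≤ maj k := by simp only [hmaj]; positivity
    by_cases hkS : k ∈ S
    · by_cases hkE : k ∈ E
      · have hk' : k = ℓ ∨ k = -ℓ := by simpa [hE] using hkE
        have : Fh k = 0 := hFℓ k hk'
        rw [this, inner_zero_left, Complex.zero_re, abs_zero]; exact hmaj0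
      · have hkE' : k ∈ ((E : Set (Fin 3 → ℤ))ᶜ) := by rwa [Set.mem_compl_iff, Finset.mem_coe]
        simp only [hmaj, Set.indicator_of_mem hkS, Set.indicator_of_mem hkE']
        calc |(⟪Fh k, gh k⟫_ℂ).re| ≤ ‖⟪Fh k, gh k⟫_ℂ‖ := Complex.abs_re_le_norm _
          _ ≤ ‖Fh k‖ * ‖gh k‖ := norm_inner_le_norm _ _
          _ ≤ α / 2 * ‖Fh k‖ ^ 2 + ‖gh k‖ ^ 2 / (2 * α) := by
              -- Young with parameter `α`: `ab ≤ (α/2)a² + b²/(2α)` since `(αa − b)² ≥ 0`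
              have e : α / 2 * ‖Fh k‖ ^ 2 + ‖gh k‖ ^ 2 / (2 * α) - ‖Fh k‖ * ‖gh k‖ =
                  (α * ‖Fh k‖ - ‖gh k‖) ^ 2 / (2 * α) := by
                field_simp; ring
              have : 0 ≤ (α * ‖Fh k‖ - ‖gh k‖) ^ 2 / (2 * α) := by positivity
              linarith
          _ = α / 2 * ‖Fh k‖ ^ 2 + (2 * α)⁻¹ * ‖gh k‖ ^ 2 := by ring
    · have : gh k = 0 := hg k hkS
      rw [this, inner_zero_right, Complex.zero_re, abs_zero]; exact hmaj0
  have habs_s : Summable fun k => ‖(⟪Fh k, gh k⟫_ℂ).re‖ :=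
    Summable.of_nonneg_of_le (fun _ => norm_nonneg _) (fun k => by rw [Real.norm_eq_abs]; exact hdom k) hmaj_s
  -- the two partial sums
  have hsumF : ∑' k, S.indicator (fun k => ‖Fh k‖ ^ 2) k = pairSectorEnergy n ℓ F := by
    rw [← tsum_subtype, pairSectorEnergy]
    exact tsum_congr fun k => (sectorEnergy_eq hFi _).symm
  have hne : ℓ ≠ -ℓ := by
    intro h'
    apply hℓ
    funext i
    have := congr_fun h' i
    simp only [Pi.neg_apply] at this
    show ℓ i = 0
    omega
  have hsumg : ∑' k, ((E : Set (Fin 3 → ℤ))ᶜ).indicator (fun k => ‖gh k‖ ^ 2) k =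
      (∫ x, ‖g x‖ ^ 2) - (‖gh ℓ‖ ^ 2 + ‖gh (-ℓ)‖ ^ 2) := by
    rw [← tsum_subtype]
    have h := hPg.summable.sum_add_tsum_compl (s := E)
    rw [hPg.tsum_eq, hE, Finset.sum_pair hne] at h
    rw [hE]
    linarith
  -- sum up
  rw [← hpair.tsum_eq]
  calc |∑' k, (⟪Fh k, gh k⟫_ℂ).re| = ‖∑' k, (⟪Fh k, gh k⟫_ℂ).re‖ := (Real.norm_eq_abs _).symm
    _ ≤ ∑' k, ‖(⟪Fh k, gh k⟫_ℂ).re‖ := norm_tsum_le_tsum_norm habs_s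
    _ ≤ ∑' k, maj k := Summable.tsum_le_tsum (fun k => by rw [Real.norm_eq_abs]; exact hdom k) habs_s hmaj_s
    _ = α / 2 * pairSectorEnergy n ℓ F + (2 * α)⁻¹ * ((∫ x, ‖g x‖ ^ 2) - (‖gh ℓ‖ ^ 2 + ‖gh (-ℓ)‖ ^ 2)) := by
        simp only [hmaj]
        rw [hs1.tsum_add hs2, tsum_mul_left, tsum_mul_left, hsumF, hsumg]
    _ ≤ α / 2 * pairSectorEnergy n ℓ F + D / (2 * α) := by
        have : (2 * α)⁻¹ * ((∫ x, ‖g x‖ ^ 2) - (‖gh ℓ‖ ^ 2 + ‖gh (-ℓ)‖ ^ 2)) ≤ (2 * α)⁻¹ * D :=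
          mul_le_mul_of_nonneg_left hD (by positivity)
        have e : (2 * α)⁻¹ * D = D / (2 * α) := by rw [inv_mul_eq_div]
        linarith

/-- Auxiliary step of the duality proof (`ne_neg_of_ne_zero`). [folklore] -/
theorem ne_neg_of_ne_zero {ℓ : Fin 3 → ℤ} (hℓ : ℓ ≠ 0) : ℓ ≠ -ℓ := by
  intro h'
  apply hℓ
  funext i
  have := congr_fun h' i
  simp only [Pi.neg_apply] at this
  show ℓ i = 0
  omega

/-- Exact `L²` norm of a single real mode: `∫‖Re(e_ℓ • z)‖² = ‖z‖²/2` for `ℓ ≠ 0` (Parseval; the coefficients are `z/2`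
at `ℓ` and `z̄/2` at `−ℓ`). [cite: Grafakos2014, Prop. 3.2.7 (3)] -/
theorem integral_norm_sq_realTrigPoly_singleton {ℓ : Fin 3 → ℤ} (hℓ : ℓ ≠ 0) (z : EuclideanSpace ℂ (Fin 3)) :
    ∫ x, ‖FunctionSpaces.Torus.realTrigPoly {ℓ} (fun _ => z) x‖ ^ 2 = ‖z‖ ^ 2 / 2 := by
  classical
  have hne := ne_neg_of_ne_zero hℓ
  rw [FunctionSpaces.Torus.integral_norm_sq_eq_tsum (FunctionSpaces.Torus.memLp_realTrigPoly _ _ 2)]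
  have hcoef : ∀ k', ‖mFourierCoeff (FunctionSpaces.EuclideanSpace.complexify ∘
      FunctionSpaces.Torus.realTrigPoly {ℓ} (fun _ => z)) k'‖ ^ 2 =
      if k' = ℓ ∨ k' = -ℓ then ‖z‖ ^ 2 / 4 else 0 := by
    intro k'
    rw [FunctionSpaces.Torus.mFourierCoeff_realTrigPoly_singleton]
    by_cases h1 : k' = ℓ
    · have h2 : k' ≠ -ℓ := by rw [h1]; exact hne
      rw [if_pos h1, if_neg h2, if_pos (Or.inl h1), EuclideanSpace.conjVec_zero, add_zero, norm_smul, mul_pow,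
        norm_inv, Complex.norm_ofNat]
      ring
    · by_cases h2 : k' = -ℓ
      · rw [if_neg h1, if_pos h2, if_pos (Or.inr h2), zero_add, norm_smul, EuclideanSpace.norm_conjVec, mul_pow,
          norm_inv, Complex.norm_ofNat]
        ring
      · rw [if_neg h1, if_neg h2, if_neg (by tauto), EuclideanSpace.conjVec_zero, add_zero, smul_zero, norm_zero]
        ring
  simp_rw [hcoef]
  rw [tsum_eq_sum (s := ({ℓ, -ℓ} : Finset (Fin 3 → ℤ)))
      (fun k' hk' => if_neg (by rwa [Finset.mem_insert, Finset.mem_singleton] at hk')),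
    Finset.sum_pair hne, if_pos (Or.inl rfl), if_pos (Or.inr rfl)]
  ring

end Summit.AnomalousDissipation.AnomalousDissipation.Theorems.SolenoidalFractalHomogenisation.LagrangianStep.CellEnergyT

end
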